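import Mathlib
import Summits.SmoothPoincare4.SmoothPoincare4.Theses.CylinderEntropy
import Literature.Geometry.Riemannian.SphericalCylinderEntropy
import Literature.Geometry.Manifold.CylinderSlice
import Literature.Topology.FourManifolds.CerfGammaFourProofs
import Literature.Topology.FourManifolds.SmoothPoincareLowDim
import Literature.Geometry.Manifold.BranchedFourSphere
import Literature.Geometry.Manifold.CorruptedAtlasSphere
import Literature.Geometry.Riemannian.TiltedSliceEntropy
import Literature.Geometry.Riemannian.ColdingMinicozziEntropyValues

/-!
# Disproof of `ThinCrossSectionExists` — findings (standing disprover of crux E, route CylinderEntropy; cycle 2)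

E (item stmt-SmoothPoincare4-7633) := every homotopy 4-sphere `M` (bare summit frame) has a smooth embedding
`ι : M → ℝ⁶` into `N = S⁴×ℝ = {∑_{i<5} z_i² = 1}` separating the two ends with typed cylinder entropy
`λ_cyl(range ι) < 4/e`.  VERDICT SO FAR: **no kill; E is SPC4 in the costume of an existence statement** —
faithful typing, non-vacuous, sandwiched `SPC4 ⇒ E` (slice) and `E ∧ R ⇒ SPC4` (route), so `¬E ⊢ ¬SPC4`
(`not_spc4_of_not_crux`): a refutation is an exotic 4-sphere all of whose cross-sections are fat.

Index of theorems (all sorry-free unless marked NEAR-MISS):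
* §0 `crux_iff` — E is literally `ThinAtLevel (ofReal (4/e))` over the tree functional
  `Literature.Geometry.Riemannian.SphericalCylinderEntropy.cylEntropy` (`Iff.rfl`); `sliceCalibration_iff`;
  `level_eq_stone` / `level_eq_bubbleSheet` (the threshold IS Stone's `Λ₂ = λ(S²×ℝ²) = 4/e`: no threshold slip);
  `one_lt_level`, `level_lt_two` (`1 < 4/e < 2`); `thinAtLevel_mono`.
* §1 LOAD-BEARING  (a1) `false_without_homotopyEquiv` — drop `M ≃ₕ S⁴` ⇒ false (empty manifold; the vertical
  segment joins the ends).  (a2) `topThinAtLevel_of_freedman` — weaken `IsSmoothEmbedding ι` to `IsEmbedding ι` ⇒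
  TRUE (given the Freedman fact `nonempty_homeomorph_sphere_four` and the calibration item): **all SPC4 content of
  E is the regularity upgrade C⁰ → C^∞ of one map**.  (a3) `crux_of_spc4`, `not_spc4_of_not_crux`,
  `crux_iff_spc4` (E ⇔ SPC4 given `CylinderRungTwo`), `crossSectionBelow_sphere` (non-vacuity at `S⁴`).
  (a4) `false_without_isManifold` — drop `[IsManifold (𝓡 4) ∞ M]` ⇒ false at `S⁴` with ONE corrupt chart added
  (construction LANDED as `Literature.Geometry.Manifold.CorruptedAtlasSphere`, p71642: `not_mem_maximalAtlas`,
  `not_isImmersion`, `not_isManifold`, `not_differentiableAt_deg_symm`): NEW in cycle 2.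
  (a5) `false_without_t2` — drop `[T2Space M]` ⇒ false: the branched 4-sphere `Flap.X` (sphere + a coordinate ball
  glued along an open half-ball) is a second-countable `C^∞` 4-manifold, `≃ₕ S⁴`, not `T₂` (construction LANDED as
  `Literature.Geometry.Manifold.BranchedFourSphere`, p71603: `core`, `homotopyEquiv`, `not_t2Space`): NEW in cycle 2 — with (a1),
  (a4), (a5) and (a2) EVERY hypothesis of E's frame is now shown load-bearing or (smoothness of ι) SPC4-carrying;
  and (a6) `withoutSecondCountable_iff` / `secondCountable_of_homotopyEquiv` — `[SecondCountableTopology M]` is REDUNDANT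
  (a Hausdorff 4-manifold `≃ₕ S⁴` is compact by `H₄`, tree theorem without countability, hence finitely charted): the
  load-bearing analysis of the frame is COMPLETE.
* §2 TIGHTNESS  `one_le_cylEntropy_range` (every compact continuous end-separating cross-section has `λ_cyl ≥ 1`),
  `not_thinAtLevel_of_le_one` (**E with any threshold ≤ 1 is false at `M = S⁴`**: free interval exactly
  `[1, 4/e)`), `one_lt_of_thinAtLevel`, `measure_lt_of_cylEntropy_lt` (a thin cross-section has 4-area
  `< (4/e)·|S⁴|`: the handle decorations of any construction must fit in `0.4716·|S⁴|`).
* §3 STRENGTHENINGS REFUTED  (c1) `two_le_cylEntropy_twoSlices`, `not_cylEntropy_twoSlices_lt_level` (no gluing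
  lemma may ignore area: two thin slices make a fat set, `λ_cyl ≥ 2`).  (c2) `not_strongE` / `not_strongE_level` /
  `exists_thin_and_fat`: the ∀-version of E is false at `S⁴` — the tilted slice `Tilt.tilt 1000 : x ↦ (x, 1000 x₀)`
  is a smooth separating cross-section with `λ_cyl ≥ 2` (construction LANDED as
  `Literature.Geometry.Riemannian.TiltedSliceEntropy`, p71685: shadow box of volume 125 vs `|S⁴| = 8π²/3`); thinness is
  not an isotopy invariant.
* §4 REFORMULATIONS  (d1) `thinAtLevel_iff_top` (given Freedman, E = its restriction to `M ≃ₜ S⁴`: E is about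
  smooth structures on the topological 4-sphere); (d2) `mu` (= the header's `μ(M) = inf λ_cyl` over cross-section
  embeddings), `crossSectionBelow_iff_mu_lt`, `crux_iff_mu` (E ⟺ ∀ homotopy spheres `μ < 4/e`), `one_le_mu`,
  `mu_sphere` (`μ(S⁴) = 1` given the calibration), `diffeomorph_of_mu_lt`, `mu_dichotomy` (given R: `μ = 1` on the
  standard sphere, `μ ≥ 4/e` on any exotic one — nothing in `(1, 4/e)`).
* LANDED THROUGH THE GATE (cycle 2): `Theorems/ThinCrossSectionExists/Negative/FrameAnalysis.lean` (p72115: the (a1),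
  (a4), (a5), (a6), (b1), (c2), (a2), (a3) statements spelled out verbatim, supports the item) and the three witness
  constructions as Literature infrastructure (p71603 BranchedFourSphere, p71642 + p71887 CorruptedAtlasSphere,
  p71685 TiltedSliceEntropy).  KERNEL LEAK TEST, kit job j007332 (done, 28 s; evidence on the item): (A) the typed finite
  sum equals `C_k^{(3/2)}` (three-term recurrence) EXACTLY in rational arithmetic for `k ≤ 14`, `C_k(1) = (k+1)(k+2)/2`, and
  numerically to `5·10⁻⁶` relative for `k ≤ 160`; (B) Funk–Hecke: `(3/4)∫_{-1}^{1} 𝔥(τ,s)(1-s²) ds = 1` exactly (only the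
  `k = 0` mode survives; quadrature `1.0` at `τ = 0.05, 0.2, 1`) — the calibration item is numerically TRUE; (C) positivity
  of `𝔥(τ,·)` on `[-1,1]` (needed by the `≤ 1` half because of `ENNReal.ofReal` clipping): minimum always at the antipode
  `s = -1`, certified `> 0` for `τ ∈ [0.023, 3]` (`𝔥(0.0231,-1) = 5.7·10⁻⁴¹`, `𝔥(0.40,-1) = 0.216`, `𝔥(3,-1) = 0.99997`);
  at `τ = 0.0154, 0.0103` the 60-digit run sits on its cancellation floor (`min ≈ -6·10⁻⁶⁰` vs true antipodal size
  `≈ e^{-π²/4τ} ≈ 10⁻⁷⁰`) — INCONCLUSIVE BY PRECISION, not a negativity (high-precision rerun: job j013793, 260 digits,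
  `τ ≥ 0.005`); (D) diagonal `𝔥(τ,1)(4πτ)²/|S⁴| = 1 + 2.02τ` at `τ = 0.01` (Minakshisundaram `1 + Rτ/6`, `R = 12`): the typed
  normalisation gives Gaussian density `1` on flat pieces.  Verdict: no normalisation leak; positivity = maximum principle
  once (A) identifies the series with `vol·H_{S⁴}`.
* Gen-1 (cycle 1) of this seat proved the same package (evidence 20260815T231416Z-Disproof.lean, unreadable from
  the gen-2 jail); everything is re-derived here on the tree files.
* WHY IT RESISTS (for provers/ideators): the only hypothesis is `M ≃ₕ S⁴`; its witnesses are exactly the smooth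
  structures on the topological 4-sphere; for the standard one the slice works, so every attack needs an exotic
  `S⁴` in Lean.  What CAN move: the calibration item (`≤ 1` half, Funk–Hecke), and upper bounds
  `μ(Σ) ≤ 4/e + δ` / `≤ √(2π/e) + δ` for handle presentations (ideator-2's ChimneyBound / TopRungBound), which are
  SPC4-free but constructive GMT.
-/

noncomputable section

set_option linter.dupNamespace false

open scoped BigOperators Topology Manifold MeasureTheory ENNReal NNReal ContDiff ContinuousMap
open Filter Set Function TopologicalSpace MeasureTheory
open Literature.Geometry.Riemannian.SphericalCylinderEntropy (cylEntropy cylDensity cylKernel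
  hausdorffMeasure_sphere_four_pos hausdorffMeasure_sphere_four_lt_top measure_ratio_le_cylEntropy
  hausdorffMeasure_sphere_le_of_separatesEnds one_le_cylEntropy_of_separatesEnds)
open Literature.Geometry.Manifold.CylinderSlice (sliceMap range_sliceMap isSmoothEmbedding_sliceMap
  sum_sq_sliceMap separatesEnds_of_slice_subset sliceMap_apply_last sliceMap_apply_castSucc twoSlices
  range_twoSlices sum_sq_twoSlices isSmoothEmbedding_twoSlices padL axis padL_apply_castSucc padL_apply_last
  padL_injective castSucc_ne_five sum_sq_eq_one)

namespace Summit.SmoothPoincare4.SmoothPoincare4.Cruxes.ThinCrossSectionExists.Disproof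

open Summit.SmoothPoincare4.SmoothPoincare4.Theses.CylinderEntropy (ThinCrossSectionExists
  CylinderRungTwo SliceCalibration AreaFloor)

local notation "E⁶" => EuclideanSpace ℝ (Fin 6)
local notation "E⁵" => EuclideanSpace ℝ (Fin 5)
local notation "E⁴" => EuclideanSpace ℝ (Fin 4)
local notation "𝕊⁴" => (Metric.sphere (0 : EuclideanSpace ℝ (Fin 5)) 1)

/-! ## §0 The crux restated through named pieces -/

/-- `z ∈ N = S⁴×ℝ ⊂ ℝ⁶`, literally as in the items: `∑_{i<5} z_i² = 1`. -/
def InN (z : E⁶) : Prop := ∑ i : Fin 5, z (Fin.castSucc i) ^ 2 = 1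

/-- The round cylinder `N` as a set. -/
def cylN : Set E⁶ := {z | InN z}

/-- "separates the two ends of `N`", literally as in the items. -/
def Separates (A : Set E⁶) : Prop :=
  ∃ R : ℝ, ∀ a b : E⁶, InN a → InN b → a 5 ≤ -R → R ≤ b 5 → ¬ JoinedIn (cylN \ A) a b

/-- `M` has an end-separating smooth cross-section embedding of typed cylinder entropy `< c`
(the four conjuncts of E with the threshold as a parameter; `cylEntropy` is the tree's verbatim copy of
the items' `⨆`-expression, `Literature.Geometry.Riemannian.SphericalCylinderEntropy.cylEntropy`). -/
def CrossSectionBelow (c : ℝ≥0∞) (M : Type) [TopologicalSpace M] [ChartedSpace E⁴ M] : Prop :=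
  ∃ ι : M → E⁶, Manifold.IsSmoothEmbedding (𝓡 4) (𝓡 6) ∞ ι ∧ (∀ x, InN (ι x)) ∧
    Separates (Set.range ι) ∧ cylEntropy (Set.range ι) < c

/-- E with a variable threshold: every homotopy 4-sphere of the bare summit shape is `CrossSectionBelow c`. -/
def ThinAtLevel (c : ℝ≥0∞) : Prop :=
  ∀ (M : Type) [TopologicalSpace M] [T2Space M] [SecondCountableTopology M]
    [ChartedSpace E⁴ M] [IsManifold (𝓡 4) ∞ M], M ≃ₕ 𝕊⁴ → CrossSectionBelow c M

/-- The bubble-sheet threshold `4/e` as typed. -/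
def level : ℝ≥0∞ := ENNReal.ofReal (4 / Real.exp 1)

/-- The crux E is *literally* `ThinAtLevel (4/e)` (definitional unfolding only). -/
theorem crux_iff : ThinCrossSectionExists ↔ ThinAtLevel level := Iff.rfl

/-- **The typed threshold is the bubble-sheet value** claimed by the route: `4/e = Λ₂` (Stone's constant, tree
`sphereEntropy_two`), and GIVEN the tree's Stone fact, `level` is the Euclidean Gaussian entropy of the bubble sheet
`S²×ℝ² ⊂ ℝ⁵` (`shrinkingCylinder 4 2`).  No threshold slip. -/
theorem level_eq_stone : level = ENNReal.ofReal (Literature.Geometry.Riemannian.sphereEntropy 2) := by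
  rw [level, Literature.Geometry.Riemannian.sphereEntropy_two]

theorem level_eq_bubbleSheet (h : Literature.Geometry.Riemannian.Stone1994_cylinderEntropy) :
    level = Literature.Geometry.Riemannian.gaussianEntropy 4 (Literature.Geometry.Riemannian.shrinkingCylinder 4 2) := by
  rw [level_eq_stone, h 4 2 (by norm_num) (by norm_num)]

/-- The support item `SliceCalibration` is literally `λ_cyl(slice₀) = 1` for the tree's `cylEntropy`. -/
theorem sliceCalibration_iff :
    SliceCalibration ↔ cylEntropy {z : E⁶ | ∑ i : Fin 5, z (Fin.castSucc i) ^ 2 = 1 ∧ z 5 = 0} = 1 :=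
  Iff.rfl

/-- `1 < 4/e` (the slice is strictly below the bubble-sheet level): `e < 4`. -/
lemma one_lt_level : (1 : ℝ≥0∞) < level := by
  rw [level, ← ENNReal.ofReal_one]
  refine (ENNReal.ofReal_lt_ofReal_iff (by positivity)).mpr ?_
  rw [lt_div_iff₀ (Real.exp_pos 1)]
  have := Real.exp_one_lt_d9
  linarith

/-- `4/e < 2` (`2 < e`). -/
lemma level_lt_two : level < 2 := by
  rw [level, show (2 : ℝ≥0∞) = ENNReal.ofReal 2 by simp]
  refine (ENNReal.ofReal_lt_ofReal_iff (by norm_num)).mpr ?_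
  rw [div_lt_iff₀ (Real.exp_pos 1)]
  have := Real.exp_one_gt_d9
  linarith

/-- Thresholds are monotone: thinner is harder. -/
theorem thinAtLevel_mono {c c' : ℝ≥0∞} (h : c ≤ c') : ThinAtLevel c → ThinAtLevel c' := by
  intro hc M _ _ _ _ _ e
  obtain ⟨ι, h1, h2, h3, h4⟩ := hc M e
  exact ⟨ι, h1, h2, h3, lt_of_lt_of_le h4 h⟩

/-! ## §1 Load-bearing hypotheses

E has exactly one mathematical hypothesis, `M ≃ₕ S⁴`, plus the frame `[T2Space M] [SecondCountableTopology M]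
[IsManifold (𝓡 4) ∞ M]` and the regularity class of `ι`. -/

/-- E with the hypothesis `M ≃ₕ S⁴` dropped. -/
def WithoutHomotopyEquiv (c : ℝ≥0∞) : Prop :=
  ∀ (M : Type) [TopologicalSpace M] [T2Space M] [SecondCountableTopology M]
    [ChartedSpace E⁴ M] [IsManifold (𝓡 4) ∞ M], CrossSectionBelow c M

/-- The point `(1,0,0,0,0,h) ∈ N` at height `h`. -/
def pole (h : ℝ) : E⁶ := EuclideanSpace.single (0 : Fin 6) (1 : ℝ) + EuclideanSpace.single (5 : Fin 6) h

lemma pole_apply_five (h : ℝ) : pole h 5 = h := by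
  simp [pole]

lemma pole_castSucc (h : ℝ) (i : Fin 5) :
    pole h (Fin.castSucc i) = if i = 0 then 1 else 0 := by
  fin_cases i <;> simp [pole, Fin.ext_iff]

lemma inN_pole (h : ℝ) : InN (pole h) := by
  simp [InN, pole_castSucc]

/-- The vertical segment between two poles lies in `N`. -/
lemma segment_pole_subset (h₁ h₂ : ℝ) : segment ℝ (pole h₁) (pole h₂) ⊆ cylN := by
  rintro z ⟨a, b, ha, hb, hab, rfl⟩
  show InN _
  have : ∀ i : Fin 5, (a • pole h₁ + b • pole h₂) (Fin.castSucc i) = if i = 0 then 1 else 0 := by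
    intro i
    simp only [PiLp.add_apply, PiLp.smul_apply, smul_eq_mul, pole_castSucc]
    split_ifs <;> nlinarith
  simp [InN, this]

/-- The empty set does not separate the ends: the vertical segment joins them. -/
theorem not_separates_empty : ¬ Separates (∅ : Set E⁶) := by
  rintro ⟨R, hR⟩
  have hS : R ≤ |R| + 1 := by have := le_abs_self R; linarith
  refine hR (pole (-(|R| + 1))) (pole (|R| + 1)) (inN_pole _) (inN_pole _) ?_ ?_ ?_
  · rw [pole_apply_five]; linarith
  · rw [pole_apply_five]; exact hS
  · rw [Set.sdiff_empty]
    exact JoinedIn.of_segment_subset (segment_pole_subset _ _)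

/-- **(a1) Any proof of E must use the homotopy equivalence**: without `M ≃ₕ S⁴` the statement fails at the
empty 4-manifold `M = ∅ ⊂ ℝ⁴` (an open submanifold), whatever the threshold: its unique map to `ℝ⁶` is a
smooth embedding with image `∅ ⊂ N` of entropy `0`, and `∅` does not separate the ends (`not_separates_empty`).
(The sibling disprovers record the other cheap witness, two slices `S⁴ ⊔ S⁴`, which fails instead at the entropy
clause: `two_le_cylEntropy_twoSlices` below.) -/
theorem false_without_homotopyEquiv (c : ℝ≥0∞) : ¬ WithoutHomotopyEquiv c := by
  intro h
  obtain ⟨ι, -, -, hsep, -⟩ := h (⊥ : Opens E⁴)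
  have : Set.range ι = ∅ := Set.range_eq_empty_iff.mpr (by
    refine ⟨fun x => ?_⟩
    exact (Set.mem_empty_iff_false _).mp (show (x : E⁴) ∈ ((⊥ : Opens E⁴) : Set E⁴) from x.2))
  rw [this] at hsep
  exact not_separates_empty hsep

/-! ### (a2) The regularity class of `ι` is where SPC4 lives: the TOP weakening of E is a theorem -/

/-- E with `Manifold.IsSmoothEmbedding` weakened to a topological embedding. -/
def TopCrossSectionBelow (c : ℝ≥0∞) (M : Type) [TopologicalSpace M] : Prop :=
  ∃ ι : M → E⁶, Topology.IsEmbedding ι ∧ (∀ x, InN (ι x)) ∧ Separates (Set.range ι) ∧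
    cylEntropy (Set.range ι) < c

/-- The topological weakening of E (same quantifier frame, `ι` only a topological embedding). -/
def TopThinAtLevel (c : ℝ≥0∞) : Prop :=
  ∀ (M : Type) [TopologicalSpace M] [T2Space M] [SecondCountableTopology M]
    [ChartedSpace E⁴ M] [IsManifold (𝓡 4) ∞ M], M ≃ₕ 𝕊⁴ → TopCrossSectionBelow c M

theorem crossSectionBelow_imp_top {c : ℝ≥0∞} {M : Type} [TopologicalSpace M] [ChartedSpace E⁴ M]
    (h : CrossSectionBelow c M) : TopCrossSectionBelow c M := by
  obtain ⟨ι, h1, h2, h3, h4⟩ := h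
  exact ⟨ι, h1.isEmbedding, h2, h3, h4⟩

theorem thinAtLevel_imp_top {c : ℝ≥0∞} (h : ThinAtLevel c) : TopThinAtLevel c :=
  fun M _ _ _ _ _ e => crossSectionBelow_imp_top (h M e)

/-- The slice `S⁴ × {0}`, image of the tree's `sliceMap 0`. -/
def slice₀ : Set E⁶ := {z : E⁶ | ∑ i : Fin 5, z (Fin.castSucc i) ^ 2 = 1 ∧ z 5 = 0}

lemma range_sliceMap_zero : Set.range (sliceMap 0) = slice₀ := range_sliceMap 0

/-- The slice separates the ends (tree: IVT on the height). -/
lemma separates_of_slice_subset {A : Set E⁶} (h : slice₀ ⊆ A) : Separates A :=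
  separatesEnds_of_slice_subset h

/-- Given the calibration item, the slice is strictly below the bubble-sheet level. -/
lemma cylEntropy_slice_lt_level (hcal : SliceCalibration) : cylEntropy slice₀ < level := by
  rw [sliceCalibration_iff] at hcal
  rw [show slice₀ = {z : E⁶ | ∑ i : Fin 5, z (Fin.castSucc i) ^ 2 = 1 ∧ z 5 = 0} from rfl, hcal]
  exact one_lt_level

/-- **(a2) TOP-E is a theorem (given Freedman's theorem and the calibration item).** If `ι` is only required
to be a topological embedding, every homotopy 4-sphere has a thin cross-section: transport the slice along a
homeomorphism `M ≃ₜ S⁴` (Freedman, tree fact `nonempty_homeomorph_sphere_four`); its image IS the slice, which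
separates (IVT) and has `λ_cyl = 1 < 4/e` (`SliceCalibration`).  Hence **all SPC4-content of E sits in the
upgrade `IsEmbedding ι ⟶ IsSmoothEmbedding ι`** (C⁰ → C^∞; by smoothing theory already C⁰ → C¹ carries it, and by
Donaldson–Sullivan's quasiconformal gauge theory plausibly even C⁰ → Lipschitz). -/
theorem topThinAtLevel_of_freedman
    (hF : Literature.Topology.FourManifolds.nonempty_homeomorph_sphere_four.{0})
    (hcal : SliceCalibration) : TopThinAtLevel level := by
  intro M _ _ _ _ _ e
  obtain ⟨φ⟩ := hF M e
  refine ⟨sliceMap 0 ∘ φ, ?_, ?_, ?_, ?_⟩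
  · exact (isSmoothEmbedding_sliceMap 0).isEmbedding.comp φ.isEmbedding
  · intro x; exact sum_sq_sliceMap 0 (φ x)
  · rw [Set.range_comp, φ.surjective.range_eq, Set.image_univ, range_sliceMap_zero]
    exact separates_of_slice_subset subset_rfl
  · rw [Set.range_comp, φ.surjective.range_eq, Set.image_univ, range_sliceMap_zero]
    exact cylEntropy_slice_lt_level hcal

/-! ### (a4) The `C^∞`-compatibility of the atlas of `M` is load-bearing: a corrupted atlas on `S⁴`

Drop `[IsManifold (𝓡 4) ∞ M]` and E fails at the topological 4-sphere itself, re-charted by all stereographic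
charts plus ONE extra chart `deg ∘ σ₁`, where `deg` cubes one coordinate (a homeomorphism of `ℝ⁴` whose inverse is
not differentiable at the centre).  Mathlib's `Manifold.IsImmersion` asks for slice charts in the MAXIMAL atlas,
and the maximal `C^∞` atlas of this charted space has no chart around the base point (`Corrupt.not_mem_maximalAtlas`),
so no map out of it is an immersion (`Corrupt.not_isImmersion`), whatever the target or the threshold. -/

/-- The corrupted-atlas sphere now lives in the tree: `Literature.Geometry.Manifold.CorruptedAtlasSphere` (landed from
this seat, p71642). -/
abbrev Corrupt.Cor : Type := Literature.Geometry.Manifold.CorruptedAtlasSphere.Cor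

/-- E with the frame hypothesis `[IsManifold (𝓡 4) ∞ M]` dropped (only a `C⁰` atlas on `M`). -/
def WithoutIsManifold (c : ℝ≥0∞) : Prop :=
  ∀ (M : Type) [TopologicalSpace M] [T2Space M] [SecondCountableTopology M] [ChartedSpace E⁴ M],
    M ≃ₕ 𝕊⁴ → CrossSectionBelow c M

/-- **(a4) Any proof of E must use the `C^∞`-compatibility of `M`'s atlas**: for the corrupted atlas on the
(compact, Hausdorff, second countable, genuinely spherical) `Corrupt.Cor ≃ₕ S⁴` there is no smooth immersion into
`ℝ⁶` at all, so E-without-`IsManifold` is false at every threshold. -/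
theorem false_without_isManifold (c : ℝ≥0∞) : ¬ WithoutIsManifold c := by
  intro h
  obtain ⟨ι, hι, -, -, -⟩ := h Literature.Geometry.Manifold.CorruptedAtlasSphere.Cor
    Literature.Geometry.Manifold.CorruptedAtlasSphere.corHomotopyEquiv
  exact Literature.Geometry.Manifold.CorruptedAtlasSphere.not_isImmersion ι hι.isImmersion

/-! ### (a5) Hausdorffness of `M` is load-bearing: the BRANCHED 4-sphere

Drop `[T2Space M]` and E fails, at every threshold: a smooth embedding into `ℝ⁶` makes its domain Hausdorff
(`IsEmbedding.t2Space`), and there is a NON-Hausdorff second-countable `C^∞` 4-manifold homotopy equivalent to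
`S⁴` — the sphere with a second copy of a coordinate ball attached along an open half-ball (`Flap.X`): it is a
`ChartedSpaceCore` whose transition maps are sphere transition maps or identities (`Flap.core`, the `IsManifold`
instance), its flap deformation retracts into the first sheet (`Flap.homotopyψ`, `Flap.homotopyEquiv : X ≃ₕ S⁴`),
and the two origins of the branch cannot be separated (`Flap.not_t2Space`).  (The cheaper "sphere with a doubled
point" is NOT `≃ₕ S⁴`: maps out of it factor through the Hausdorff quotient.)  NEW in cycle 2. -/

/-- The branched 4-sphere now lives in the tree: `Literature.Geometry.Manifold.BranchedFourSphere` (landed from this seat,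
p71603). -/
abbrev Flap.X : Type := Literature.Geometry.Manifold.BranchedFourSphere.X

/-- E with the frame hypothesis `[T2Space M]` dropped. -/
def WithoutT2 (c : ℝ≥0∞) : Prop :=
  ∀ (M : Type) [TopologicalSpace M] [SecondCountableTopology M] [ChartedSpace E⁴ M] [IsManifold (𝓡 4) ∞ M],
    M ≃ₕ 𝕊⁴ → CrossSectionBelow c M

/-- **(a5) Any proof of E must use that `M` is Hausdorff**: the branched 4-sphere `Flap.X` (second countable,
`C^∞`, `≃ₕ S⁴`, not `T₂`) has no smooth — indeed no topological — embedding into `ℝ⁶`. -/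
theorem false_without_t2 (c : ℝ≥0∞) : ¬ WithoutT2 c := by
  intro h
  obtain ⟨ι, hι, -, -, -⟩ := h Literature.Geometry.Manifold.BranchedFourSphere.X
    Literature.Geometry.Manifold.BranchedFourSphere.homotopyEquiv
  exact Literature.Geometry.Manifold.BranchedFourSphere.not_t2Space hι.isEmbedding.t2Space

/-! ### (a6) Second countability of `M` is REDUNDANT (the only non-load-bearing frame hypothesis)

A Hausdorff topological 4-manifold `M : Type` homotopy equivalent to `S⁴` is compact — `H₄` of a connected non-compact
HAUSDORFF manifold vanishes (tree theorem `isZero_singularHomology_of_noncompactSpace_holds`, Hatcher Prop. 3.29, which needs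
no countability axiom) while `H₄(S⁴) ≠ 0` — hence finitely many chart domains cover it, hence it is second countable.  So E with
`[SecondCountableTopology M]` dropped is EQUIVALENT to E.  Together with (a1), (a4), (a5): the frame `{≃ₕ S⁴, T2, C^∞-atlas}` is
exactly the load-bearing part, `SecondCountable` is decoration, and the regularity of `ι` carries SPC4 (a2). -/

/-- A Hausdorff 4-manifold (no countability assumed) homotopy equivalent to `S⁴` is compact. -/
theorem compactSpace_of_homotopyEquiv_noSC (M : Type) [TopologicalSpace M] [T2Space M] [ChartedSpace E⁴ M]
    (e : M ≃ₕ 𝕊⁴) : CompactSpace M := by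
  by_contra hM
  haveI : NoncompactSpace M := not_compactSpace_iff.mp hM
  haveI := Literature.Topology.FourManifolds.pathConnectedSpace_euclideanSphere (n := 4) (by norm_num)
  haveI : PathConnectedSpace M := Literature.Topology.FourManifolds.pathConnectedSpace_of_homotopyEquiv e
  have hz : CategoryTheory.Limits.IsZero
      (Literature.AlgebraicTopology.SingularHomology.singularHomology ℤ ℤ M 4) :=
    Literature.AlgebraicTopology.SingularHomology.isZero_singularHomology_of_noncompactSpace_holds ℤ M 4 le_rfl
  exact Literature.AlgebraicTopology.SingularHomology.not_isZero_singularHomology_unitSphere ℤ ℤ 4 (by norm_num)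
    (hz.of_iso (Literature.AlgebraicTopology.SingularHomology.singularHomology.isoOfHomotopyEquiv ℤ ℤ e 4).symm)

/-- **(a6) Second countability is implied by the rest of the frame** (`M : Type`, Hausdorff, charted over `ℝ⁴`, `≃ₕ S⁴`). -/
theorem secondCountable_of_homotopyEquiv (M : Type) [TopologicalSpace M] [T2Space M] [ChartedSpace E⁴ M]
    (e : M ≃ₕ 𝕊⁴) : SecondCountableTopology M := by
  haveI := compactSpace_of_homotopyEquiv_noSC M e
  obtain ⟨s, -, hsfin, hcover⟩ := isCompact_univ.elim_finite_subcover_image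
    (b := (univ : Set M)) (c := fun x : M => (chartAt E⁴ x).source) (fun x _ => (chartAt E⁴ x).open_source)
    (fun x _ => mem_iUnion₂.mpr ⟨x, mem_univ x, mem_chart_source E⁴ x⟩)
  exact ChartedSpace.secondCountable_of_countable_cover E⁴ (s := s) (univ_subset_iff.mp hcover) hsfin.countable

/-- E with the frame hypothesis `[SecondCountableTopology M]` dropped. -/
def WithoutSecondCountable (c : ℝ≥0∞) : Prop :=
  ∀ (M : Type) [TopologicalSpace M] [T2Space M] [ChartedSpace E⁴ M] [IsManifold (𝓡 4) ∞ M],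
    M ≃ₕ 𝕊⁴ → CrossSectionBelow c M

/-- **(a6)** Dropping second countability does not change E (at any threshold). -/
theorem withoutSecondCountable_iff (c : ℝ≥0∞) : WithoutSecondCountable c ↔ ThinAtLevel c := by
  constructor
  · intro h M _ _ _ _ _ e; exact h M e
  · intro h M _ _ _ _ e
    haveI := secondCountable_of_homotopyEquiv M e
    exact h M e

/-! ### (a3) The SPC4 sandwich: E ⇐ SPC4 (given the calibration), and E ⇔ SPC4 given R -/

/-- A manifold diffeomorphic to `S⁴` has a thin cross-section: the slice transported along the
diffeomorphism (tree: `Manifold.IsSmoothEmbedding.comp_diffeomorph`, `isSmoothEmbedding_sliceMap`). -/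
theorem crossSectionBelow_of_diffeomorph (hcal : SliceCalibration) {M : Type} [TopologicalSpace M]
    [ChartedSpace E⁴ M] [IsManifold (𝓡 4) ∞ M] (φ : M ≃ₘ⟮𝓡 4, 𝓡 4⟯ 𝕊⁴) :
    CrossSectionBelow level M := by
  have hr : Set.range (sliceMap 0 ∘ φ) = slice₀ := by
    rw [← range_sliceMap_zero]
    ext z
    simp only [Set.mem_range, Function.comp_apply]
    constructor
    · rintro ⟨x, rfl⟩; exact ⟨φ x, rfl⟩
    · rintro ⟨y, rfl⟩; exact ⟨φ.symm y, by simp⟩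
  refine ⟨sliceMap 0 ∘ φ, ?_, ?_, ?_, ?_⟩
  · exact (isSmoothEmbedding_sliceMap 0).comp_diffeomorph φ
  · intro x; exact sum_sq_sliceMap 0 (φ x)
  · rw [hr]; exact separates_of_slice_subset subset_rfl
  · rw [hr]; exact cylEntropy_slice_lt_level hcal

/-- **Non-vacuity**: the conclusion of E holds at `M = S⁴` (given the calibration item). -/
theorem crossSectionBelow_sphere (hcal : SliceCalibration) : CrossSectionBelow level 𝕊⁴ :=
  crossSectionBelow_of_diffeomorph hcal (Diffeomorph.refl _ _ _)

/-- **E ⇐ SPC4** (given the calibration item): the slice through the diffeomorphism `M ≅ S⁴`. -/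
theorem crux_of_spc4 (hcal : SliceCalibration) (h : _root_.SmoothPoincare4) : ThinCrossSectionExists := by
  rw [crux_iff]
  intro M _ _ _ _ _ e
  obtain ⟨φ⟩ := h M ‹ChartedSpace E⁴ M› ‹IsManifold (𝓡 4) ∞ M› e
  exact crossSectionBelow_of_diffeomorph hcal φ

/-- Contrapositive: **a refutation of E is a disproof of SPC4** (given the calibration item) — this is WHY E
resists every cheap attack: a counterexample is an exotic 4-sphere all of whose cross-sections are fat. -/
theorem not_spc4_of_not_crux (hcal : SliceCalibration) (h : ¬ ThinCrossSectionExists) : ¬ _root_.SmoothPoincare4 :=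
  fun hs => h (crux_of_spc4 hcal hs)

/-- **E ⇔ SPC4 given R** (= `CylinderRungTwo`) and the calibration: the route's `closes` one way, the slice the
other. So, modulo the recognition crux, E is SPC4 itself. -/
theorem crux_iff_spc4 (hR : CylinderRungTwo) (hcal : SliceCalibration) :
    ThinCrossSectionExists ↔ _root_.SmoothPoincare4 :=
  ⟨fun hE => Summit.SmoothPoincare4.SmoothPoincare4.Theses.CylinderEntropy.closes hR hE, crux_of_spc4 hcal⟩

/-! ## §2 Tightness: the threshold cannot be lowered to `1` (free interval is exactly `[1, 4/e)`) -/

/-- Compact cross-sections have bounded height. -/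
lemma exists_height_bound {M : Type} [TopologicalSpace M] [CompactSpace M] {ι : M → E⁶}
    (hι : Continuous ι) : ∃ B : ℝ, ∀ z ∈ Set.range ι, |z 5| ≤ B := by
  have hc : Continuous fun x => |ι x 5| := by fun_prop
  obtain ⟨B, hB⟩ := (isCompact_range hc).isBounded.subset_closedBall_lt 0 0 |>.imp fun B h => h.2
  refine ⟨B, ?_⟩
  rintro z ⟨x, rfl⟩
  have := hB (Set.mem_range_self x)
  simpa [Real.dist_eq, abs_abs] using this

/-- **Entropy floor**: every compact end-separating cross-section in `N` has typed `λ_cyl ≥ 1`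
(area floor `μH⁴(range ι) ≥ μH⁴(S⁴)` by the 1-Lipschitz shadow, plus the `τ → ∞` limit of the typed kernel;
both from the tree file `SphericalCylinderEntropy`). No smoothness is used, only continuity. -/
theorem one_le_cylEntropy_range {M : Type} [TopologicalSpace M] [CompactSpace M] {ι : M → E⁶}
    (hι : Continuous ι) (hN : ∀ x, InN (ι x)) (hsep : Separates (Set.range ι)) :
    1 ≤ cylEntropy (Set.range ι) := by
  obtain ⟨B, hB⟩ := exists_height_bound hι
  obtain ⟨R, hR⟩ := hsep
  refine one_le_cylEntropy_of_separatesEnds (isCompact_range hι).isClosed.measurableSet ?_ hB (R := R) ?_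
  · rintro z ⟨x, rfl⟩; exact hN x
  · intro a b ha hb ha5 hb5
    exact hR a b ha hb ha5 hb5

/-- **(b1) TIGHTNESS.** E with any threshold `c ≤ 1` is FALSE, already at `M = S⁴` (which is compact, so every
candidate `ι` has `λ_cyl ≥ 1 ≥ c`): the free interval of the route is exactly `[1, 4/e)`; no flow or variational
argument can push a cross-section below the slices. Unconditional (no calibration needed for this direction). -/
theorem not_thinAtLevel_of_le_one {c : ℝ≥0∞} (hc : c ≤ 1) : ¬ ThinAtLevel c := by
  intro h
  obtain ⟨ι, hι, hN, hsep, hlt⟩ := h 𝕊⁴ (ContinuousMap.HomotopyEquiv.refl _)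
  have h1 := one_le_cylEntropy_range hι.isEmbedding.continuous hN hsep
  exact absurd (lt_of_lt_of_le hlt hc) (not_lt.mpr h1)

/-- Corollary: `ThinAtLevel c` can only hold for `1 < c`; at `c = 4/e` it is the crux. -/
theorem one_lt_of_thinAtLevel {c : ℝ≥0∞} (h : ThinAtLevel c) : 1 < c :=
  not_le.mp fun hc => not_thinAtLevel_of_le_one hc h

/-- **(b2) Area budget of a thin cross-section**: `λ_cyl(range ι) < c` forces `μH⁴(range ι) < c · μH⁴(S⁴)`;
at `c = 4/e` a thin cross-section has total 4-area `< 1.4716 · |S⁴|` while containing a full `|S⁴|` of shadow —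
every handle decoration (arches, chimneys, tubes) must fit in `0.4716 · |S⁴|` of area. -/
theorem measure_lt_of_cylEntropy_lt {M : Type} [TopologicalSpace M] [CompactSpace M] {ι : M → E⁶}
    (hι : Continuous ι) (hN : ∀ x, InN (ι x)) {c : ℝ≥0∞} (hlt : cylEntropy (Set.range ι) < c) :
    μH[4] (Set.range ι) < c * μH[4] (𝕊⁴ : Set E⁵) := by
  obtain ⟨B, hB⟩ := exists_height_bound hι
  have h := measure_ratio_le_cylEntropy (isCompact_range hι).isClosed.measurableSet
    (by rintro z ⟨x, rfl⟩; exact hN x) hB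
  have h2 : (μH[4] (𝕊⁴ : Set E⁵))⁻¹ * μH[4] (Set.range ι) < c := lt_of_le_of_lt h hlt
  have hpos := hausdorffMeasure_sphere_four_pos
  have htop := hausdorffMeasure_sphere_four_lt_top
  calc μH[4] (Set.range ι) = μH[4] (𝕊⁴ : Set E⁵) * ((μH[4] (𝕊⁴ : Set E⁵))⁻¹ * μH[4] (Set.range ι)) := by
        rw [← mul_assoc, ENNReal.mul_inv_cancel hpos.ne' htop.ne, one_mul]
    _ = (μH[4] (𝕊⁴ : Set E⁵))⁻¹ * μH[4] (Set.range ι) * μH[4] (𝕊⁴ : Set E⁵) := mul_comm _ _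
    _ < c * μH[4] (𝕊⁴ : Set E⁵) := ENNReal.mul_lt_mul_left hpos.ne' htop.ne h2

/-! ## §3 Natural strengthenings refuted -/

/-- **(c1) No gluing lemma may ignore area: two thin pieces make a fat set.** The union of the slices at heights
`0` and `1` (each of entropy `1` given the calibration, each separating) has typed `λ_cyl ≥ 2 > 4/e`. So
"`λ_cyl(A ∪ B) ≤ max(λ_cyl A, λ_cyl B) + small`" is false in the large: the functional charges total area
(compare (b2)), unlike Gaussian density ratios at a fixed small scale. -/
theorem two_le_cylEntropy_twoSlices : 2 ≤ cylEntropy (Set.range twoSlices) := by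
  have hmeas : MeasurableSet (Set.range twoSlices) :=
    (isCompact_range isSmoothEmbedding_twoSlices.isEmbedding.continuous).isClosed.measurableSet
  have hN : ∀ z ∈ Set.range twoSlices, ∑ i : Fin 5, z (Fin.castSucc i) ^ 2 = 1 := by
    rintro z ⟨x, rfl⟩; exact sum_sq_twoSlices x
  have hB : ∀ z ∈ Set.range twoSlices, |z 5| ≤ 1 := by
    intro z hz
    rw [range_twoSlices] at hz
    rcases hz with ⟨-, h⟩ | ⟨-, h⟩ <;> simp [h]
  have h := measure_ratio_le_cylEntropy hmeas hN hB
  have hsplit : μH[4] (Set.range twoSlices) = 2 * μH[4] (𝕊⁴ : Set E⁵) := by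
    rw [range_twoSlices, measure_union]
    · rw [← range_sliceMap 0, ← range_sliceMap 1,
        Literature.Geometry.Riemannian.SphericalCylinderEntropy.hausdorffMeasure_range_sliceMap,
        Literature.Geometry.Riemannian.SphericalCylinderEntropy.hausdorffMeasure_range_sliceMap, two_mul]
    · rw [Set.disjoint_iff]
      rintro z ⟨⟨-, h0⟩, ⟨-, h1⟩⟩
      rw [h0] at h1; exact zero_ne_one h1
    · rw [← range_sliceMap 1]
      exact Literature.Geometry.Riemannian.SphericalCylinderEntropy.measurableSet_range_sliceMap 1
  rw [hsplit, ← mul_assoc, mul_comm _ (2 : ℝ≥0∞), mul_assoc,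
    ENNReal.inv_mul_cancel hausdorffMeasure_sphere_four_pos.ne' hausdorffMeasure_sphere_four_lt_top.ne,
    mul_one] at h
  exact h

theorem not_cylEntropy_twoSlices_lt_level : ¬ cylEntropy (Set.range twoSlices) < level :=
  not_lt.mpr (le_trans level_lt_two.le two_le_cylEntropy_twoSlices)


/-! ### (c2) The ∀-strengthening of E is false: a FAT smooth cross-section of the standard sphere

"Every smooth end-separating cross-section embedding of every homotopy 4-sphere is thin" fails at `M = S⁴`:
tilt the slice, `x ↦ (x, 1000·x₀)`.  It is a smooth embedding (tree immersion criterion), lies in `N`, separates the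
ends (IVT on `z₅ - 1000 z₀`), and its 1-Lipschitz shadow `z ↦ (z₅, z₁, z₂, z₃)` covers the box
`[-500, 500] × [-1/4, 1/4]³` of volume `125`, so `λ_cyl ≥ μH⁴(range)/μH⁴(S⁴) ≥ 125 / (8π²/3) > 2 > 4/e`.
(It is isotopic to the slice through the smooth cross-sections `x ↦ (x, A x₀)`, `A ∈ [0, 1000]`: thinness is not
an isotopy invariant of cross-sections, so E is a statement about a distinguished representative, not a class.) -/

/-- The fat tilted cross-section now lives in the tree: `Literature.Geometry.Riemannian.TiltedSliceEntropy` (landed from this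
seat, p71685). -/
abbrev Tilt.tilt (A : ℝ) : 𝕊⁴ → E⁶ := Literature.Geometry.Riemannian.TiltedSliceEntropy.tilt A

namespace Tilt
open Literature.Geometry.Riemannian.TiltedSliceEntropy

theorem isSmoothEmbedding_tilt (A : ℝ) : Manifold.IsSmoothEmbedding (𝓡 4) (𝓡 6) ∞ (Tilt.tilt A) :=
  Literature.Geometry.Riemannian.TiltedSliceEntropy.isSmoothEmbedding_tilt A

theorem sum_sq_tilt (A : ℝ) (x : 𝕊⁴) : InN (Tilt.tilt A x) :=
  Literature.Geometry.Riemannian.TiltedSliceEntropy.sum_sq_tilt A x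

theorem separates_range_tilt (A : ℝ) : Separates (Set.range (Tilt.tilt A)) :=
  Literature.Geometry.Riemannian.TiltedSliceEntropy.separates_range_tilt A

theorem two_le_cylEntropy_tilt : 2 ≤ cylEntropy (Set.range (Tilt.tilt 1000)) :=
  Literature.Geometry.Riemannian.TiltedSliceEntropy.two_le_cylEntropy_tilt

end Tilt

/-- The ∀-strengthening of E at threshold `c`: EVERY smooth end-separating cross-section embedding is `c`-thin. -/
def StrongE (c : ℝ≥0∞) : Prop :=
  ∀ (M : Type) [TopologicalSpace M] [T2Space M] [SecondCountableTopology M]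
    [ChartedSpace E⁴ M] [IsManifold (𝓡 4) ∞ M], M ≃ₕ 𝕊⁴ →
    ∀ ι : M → E⁶, Manifold.IsSmoothEmbedding (𝓡 4) (𝓡 6) ∞ ι → (∀ x, InN (ι x)) →
      Separates (Set.range ι) → cylEntropy (Set.range ι) < c

/-- **(c2) `StrongE c` is false for every `c ≤ 2`, in particular at `c = 4/e`**: the tilted slice of `S⁴`. -/
theorem not_strongE {c : ℝ≥0∞} (hc : c ≤ 2) : ¬ StrongE c := by
  intro h
  have hlt := h 𝕊⁴ (ContinuousMap.HomotopyEquiv.refl _) (Tilt.tilt 1000) (Tilt.isSmoothEmbedding_tilt 1000)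
    (Tilt.sum_sq_tilt 1000) (Tilt.separates_range_tilt 1000)
  exact absurd (lt_of_lt_of_le hlt hc) (not_lt.mpr Tilt.two_le_cylEntropy_tilt)

theorem not_strongE_level : ¬ StrongE level := not_strongE level_lt_two.le

/-- The standard sphere has BOTH a thin cross-section (the slice, `λ_cyl = 1`, given the calibration) and a fat one
(the tilted slice, `λ_cyl ≥ 2`): E selects a representative. -/
theorem exists_thin_and_fat (hcal : SliceCalibration) :
    (∃ ι : 𝕊⁴ → E⁶, Manifold.IsSmoothEmbedding (𝓡 4) (𝓡 6) ∞ ι ∧ (∀ x, InN (ι x)) ∧ Separates (Set.range ι) ∧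
      cylEntropy (Set.range ι) < level) ∧
    (∃ ι : 𝕊⁴ → E⁶, Manifold.IsSmoothEmbedding (𝓡 4) (𝓡 6) ∞ ι ∧ (∀ x, InN (ι x)) ∧ Separates (Set.range ι) ∧
      2 ≤ cylEntropy (Set.range ι)) :=
  ⟨crossSectionBelow_sphere hcal,
    ⟨Tilt.tilt 1000, Tilt.isSmoothEmbedding_tilt 1000, Tilt.sum_sq_tilt 1000, Tilt.separates_range_tilt 1000,
      Tilt.two_le_cylEntropy_tilt⟩⟩


/-! ## §4 Reformulations the provers may prefer

(d1) E is a statement about the smooth structures on the TOPOLOGICAL 4-sphere (given Freedman);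
(d2) E through the route header's complexity `μ(M) := inf λ_cyl` over cross-section embeddings. -/

/-- E restricted to manifolds HOMEOMORPHIC to `S⁴`. -/
def ThinAtLevelTop (c : ℝ≥0∞) : Prop :=
  ∀ (M : Type) [TopologicalSpace M] [T2Space M] [SecondCountableTopology M]
    [ChartedSpace E⁴ M] [IsManifold (𝓡 4) ∞ M], M ≃ₜ 𝕊⁴ → CrossSectionBelow c M

/-- **(d1)** Given Freedman's theorem, E is equivalent to its restriction to smooth structures on the topological
4-sphere (`M ≃ₜ S⁴`): the homotopy equivalence carries no information beyond the homeomorphism type. -/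
theorem thinAtLevel_iff_top (hF : Literature.Topology.FourManifolds.nonempty_homeomorph_sphere_four.{0})
    (c : ℝ≥0∞) : ThinAtLevel c ↔ ThinAtLevelTop c := by
  constructor
  · intro h M _ _ _ _ _ φ
    exact h M φ.toHomotopyEquiv
  · intro h M _ _ _ _ _ e
    obtain ⟨φ⟩ := hF M e
    exact h M φ

/-- The route header's complexity: `μ_c(M) = inf` of the typed cylinder entropy over all smooth end-separating
cross-section embeddings of `M` into `N` (`= ⊤` if there is none). -/
def mu (M : Type) [TopologicalSpace M] [ChartedSpace E⁴ M] : ℝ≥0∞ :=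
  ⨅ (ι : M → E⁶) (_ : Manifold.IsSmoothEmbedding (𝓡 4) (𝓡 6) ∞ ι ∧ (∀ x, InN (ι x)) ∧ Separates (Set.range ι)),
    cylEntropy (Set.range ι)

/-- `CrossSectionBelow c M ↔ μ(M) < c` (an infimum in a complete linear order is `< c` iff some value is). -/
theorem crossSectionBelow_iff_mu_lt (c : ℝ≥0∞) (M : Type) [TopologicalSpace M] [ChartedSpace E⁴ M] :
    CrossSectionBelow c M ↔ mu M < c := by
  unfold mu CrossSectionBelow
  rw [iInf_lt_iff]
  constructor
  · rintro ⟨ι, h1, h2, h3, h4⟩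
    exact ⟨ι, (iInf_pos (p := _ ∧ _ ∧ _) ⟨h1, h2, h3⟩).trans_lt h4⟩
  · rintro ⟨ι, hι⟩
    rw [iInf_lt_iff] at hι
    obtain ⟨⟨h1, h2, h3⟩, h4⟩ := hι
    exact ⟨ι, h1, h2, h3, h4⟩

/-- **(d2)** E ⟺ every homotopy 4-sphere has `μ < 4/e`. -/
theorem crux_iff_mu : ThinCrossSectionExists ↔
    ∀ (M : Type) [TopologicalSpace M] [T2Space M] [SecondCountableTopology M]
      [ChartedSpace E⁴ M] [IsManifold (𝓡 4) ∞ M], M ≃ₕ 𝕊⁴ → mu M < level := by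
  rw [crux_iff]
  constructor
  · intro h M _ _ _ _ _ e; exact (crossSectionBelow_iff_mu_lt level M).mp (h M e)
  · intro h M _ _ _ _ _ e; exact (crossSectionBelow_iff_mu_lt level M).mpr (h M e)

/-- **`μ ≥ 1` on compact manifolds** (entropy floor), so `μ(S⁴) = 1` given the calibration (`mu_sphere`), and
given `CylinderRungTwo` the spectrum of `μ` on homotopy 4-spheres is `⊆ {1} ∪ [4/e, ⊤]` (`mu_dichotomy`). -/
theorem one_le_mu (M : Type) [TopologicalSpace M] [CompactSpace M] [ChartedSpace E⁴ M] : 1 ≤ mu M := by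
  refine le_iInf₂ fun ι hι => ?_
  exact one_le_cylEntropy_range hι.1.isEmbedding.continuous hι.2.1 hι.2.2

theorem mu_sphere (hcal : SliceCalibration) : mu 𝕊⁴ = 1 := by
  refine le_antisymm ?_ (one_le_mu _)
  have hr : Set.range (sliceMap 0) = slice₀ := range_sliceMap_zero
  refine iInf₂_le_of_le (sliceMap 0) ⟨isSmoothEmbedding_sliceMap 0, fun x => sum_sq_sliceMap 0 x,
    hr ▸ separates_of_slice_subset subset_rfl⟩ ?_
  rw [hr, show slice₀ = {z : E⁶ | ∑ i : Fin 5, z (Fin.castSucc i) ^ 2 = 1 ∧ z 5 = 0} from rfl,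
    sliceCalibration_iff.mp hcal]

/-- Given the recognition crux R, a homotopy 4-sphere with `μ < 4/e` is diffeomorphic to `S⁴`. -/
theorem diffeomorph_of_mu_lt (hR : CylinderRungTwo) {M : Type} [TopologicalSpace M] [T2Space M]
    [SecondCountableTopology M] [ChartedSpace E⁴ M] [IsManifold (𝓡 4) ∞ M] (e : M ≃ₕ 𝕊⁴) (hμ : mu M < level) :
    Nonempty (M ≃ₘ⟮𝓡 4, 𝓡 4⟯ 𝕊⁴) := by
  obtain ⟨ι, h1, h2, ⟨R, h3⟩, h4⟩ := (crossSectionBelow_iff_mu_lt level M).mpr hμ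
  exact hR M e ι h1 h2 ⟨R, h3⟩ h4

/-- **The dichotomy** (given R and the calibration): for a homotopy 4-sphere, `μ(M) = 1` if `M ≅ S⁴` and
`μ(M) ≥ 4/e` otherwise — the "free interval" `(1, 4/e)` of the route contains no value of `μ`. -/
theorem mu_dichotomy (hR : CylinderRungTwo) (hcal : SliceCalibration) {M : Type} [TopologicalSpace M] [T2Space M]
    [SecondCountableTopology M] [ChartedSpace E⁴ M] [IsManifold (𝓡 4) ∞ M] (e : M ≃ₕ 𝕊⁴) :
    (Nonempty (M ≃ₘ⟮𝓡 4, 𝓡 4⟯ 𝕊⁴) ∧ mu M < level) ∨ (IsEmpty (M ≃ₘ⟮𝓡 4, 𝓡 4⟯ 𝕊⁴) ∧ level ≤ mu M) := by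
  by_cases h : mu M < level
  · exact Or.inl ⟨diffeomorph_of_mu_lt hR e h, h⟩
  · refine Or.inr ⟨⟨fun φ => h ?_⟩, not_lt.mp h⟩
    exact (crossSectionBelow_iff_mu_lt level M).mp (crossSectionBelow_of_diffeomorph hcal φ)

end Summit.SmoothPoincare4.SmoothPoincare4.Cruxes.ThinCrossSectionExists.Disproof

end
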